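import Summits.FinalStateConjecture.FinalStateConjecture.Theorems.SwallowTheDatumSubdataDevelopmentsEmbedSkeleton
import Summits.FinalStateConjecture.FinalStateConjecture.Theorems.SwallowTheDatumSubdataDevelopmentsEmbedDoD
import Literature.Geometry.Lorentzian.CauchyDevelopmentPieceDomain

/-!
# Route SwallowTheDatum · item `SubdataDevelopmentsEmbed` (stmt-FinalStateConjecture-10053) —
# hypothesis (2) of the skeleton (`hdod`, the domain of dependence) DISCHARGED

`subdataDevelopmentsEmbed_of_skeleton` (`…SubdataDevelopmentsEmbedSkeleton.lean`) proves the item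
from three displayed hypotheses `hloc` (local geometric uniqueness — PDE), `hdod` (the domain of
dependence develops the sub-data — causality theory) and `hmax` (no corresponding boundary points +
gluing). `hdod_of_cauchyRegion` (`…SubdataDevelopmentsEmbedDoD.lean`) reduced `hdod` to the bare
causal statement `hc`: *for every vacuum Cauchy development `𝒟` of data on `X` and every smooth
open embedding `Φ : N → X` there is an open connected `V ⊆ M` containing `ι(Φ N)` in which
`ι(Φ N)` is a Cauchy hypersurface*. That statement is now a theorem of the Literature:
`CauchyDevelopment.exists_isConnected_restrict_range_comp`
(`Literature/Geometry/Lorentzian/CauchyDevelopmentPieceDomain.lean`, with `CauchyPieceDomain`,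
`CausalCurveEndpoint`, `SpacelikePieceDomain`: the Cauchy property of an open piece `A` of the
spacelike Cauchy hypersurface `S = ι(X)` in the component of
`M ∖ closure (I⁺(S ∖ A) ∪ I⁻(S ∖ A) ∪ (S ∖ A))` containing it; Hawking–Ellis 1973, Prop. 6.6.3,
O'Neill 1983, Ch. 14, Thm. 14.38 / Lemma 14.43). Hence:

* `cauchyRegion_holds` — `hc` outright;
* `hdod_holds` — hypothesis (2) of the skeleton outright;
* `subdataDevelopmentsEmbed_of_hloc_of_hmax` — **the item from the two remaining hypotheses**
  `hloc` (local geometric uniqueness, Choquet-Bruhat–Geroch 1969, Thm. 2) and `hmax`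
  (Sbierski 2016, Thm. 3.5 with the gluing of §3.2–3.3).

Pure composition; no definition, no named fact.
-/

noncomputable section

open Function Set Filter Topology TopologicalSpace
open scoped Manifold ContDiff Topology

-- `Summit.FinalStateConjecture.FinalStateConjecture.…`: summit = sub-problem name (D-0017), as in every file here
set_option linter.dupNamespace false

namespace Summit.FinalStateConjecture.FinalStateConjecture.Theorems

namespace SubdataDevelopmentsEmbed

open Literature.Geometry.Lorentzian

/-- **The causal statement `hc` of `hdod_of_cauchyRegion` holds**: for every vacuum Cauchy
development `𝒟` of data on `X` and every open embedding `Φ : N → X` of a connected manifold there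
is an open connected `V ⊆ M` containing `ι(Φ N)` in which `ι(Φ N)` is a Cauchy hypersurface —
`CauchyDevelopment.exists_isConnected_restrict_range_comp` (the smoothness of `Φ` and the
injectivity of its differential are not needed). Hawking–Ellis 1973, Prop. 6.6.3; O'Neill 1983,
Ch. 14, Thm. 14.38 / Lemma 14.43. -/
theorem cauchyRegion_holds :
    ∀ (X : Type) [TopologicalSpace X] [ChartedSpace E3 X] [IsManifold (𝓡 3) ∞ X]
      [T2Space X] [SecondCountableTopology X] [ConnectedSpace X] (D : InitialDataSet (𝓡 3) X)
      (𝒟 : VacuumCauchyDevelopment D) (N : Type) [TopologicalSpace N] [ChartedSpace E3 N]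
      [IsManifold (𝓡 3) ∞ N] [ConnectedSpace N] (Φ : N → X)
      (_hΦ : ContMDiff (𝓡 3) (𝓡 3) (∞ + 1) Φ) (_hΦ' : ∀ u, Injective (mfderiv (𝓡 3) (𝓡 3) Φ u)),
      IsOpenEmbedding Φ →
      ∃ V : Opens 𝒟.carrier, IsConnected (V : Set 𝒟.carrier) ∧ (∀ u, 𝒟.embed (Φ u) ∈ V) ∧
        (𝒟.metric.restrict PseudoRiemannianMetric.contMDiff_restrict_holds V).IsCauchyHypersurface
          (𝒟.timeOrientation.restrict PseudoRiemannianMetric.contMDiff_restrict_holds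
            𝒟.timeOrientation.contMDiff_restrict_holds V) (Subtype.val ⁻¹' range (𝒟.embed ∘ Φ)) :=
  fun _ _ _ _ _ _ _ _ 𝒟 _ _ _ _ _ _ _ _ hΦo ↦
    𝒟.toCauchyDevelopment.exists_isConnected_restrict_range_comp hΦo

/-- **Hypothesis (2) of the skeleton (`hdod`) holds**: for every vacuum Cauchy development `𝒟` of
`D` on `X` and every smooth open embedding `Φ : N → X` with injective differentials there are a
vacuum Cauchy development `R` of `D.comap Φ` and a smooth, isometric, time-orientation preserving
open embedding `χ : R → 𝒟` over `Φ` — `hdod_of_cauchyRegion` fed with `cauchyRegion_holds`.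
Hawking–Ellis 1973, §6.5–6.6; Choquet-Bruhat–Geroch 1969, p. 333. -/
theorem hdod_holds :
    ∀ (X : Type) [TopologicalSpace X] [ChartedSpace E3 X] [IsManifold (𝓡 3) ∞ X]
      [T2Space X] [SecondCountableTopology X] [ConnectedSpace X] (D : InitialDataSet (𝓡 3) X)
      (𝒟 : VacuumCauchyDevelopment D) (N : Type) [TopologicalSpace N] [ChartedSpace E3 N]
      [IsManifold (𝓡 3) ∞ N] [ConnectedSpace N] (Φ : N → X)
      (hΦ : ContMDiff (𝓡 3) (𝓡 3) (∞ + 1) Φ) (hΦ' : ∀ u, Injective (mfderiv (𝓡 3) (𝓡 3) Φ u)),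
      IsOpenEmbedding Φ →
      ∃ (R : VacuumCauchyDevelopment (D.comap Φ hΦ hΦ')) (χ : R.carrier → 𝒟.carrier),
        ContMDiff (𝓡 4) (𝓡 4) ∞ χ ∧ IsOpenEmbedding χ ∧
          R.metric.IsIsometricImmersion 𝒟.metric.toPseudoRiemannianMetric χ ∧
          R.timeOrientation.PreservesTimeOrientation χ 𝒟.timeOrientation ∧
          χ ∘ R.embed = 𝒟.embed ∘ Φ :=
  fun X _ _ _ _ _ _ D 𝒟 N _ _ _ _ Φ hΦ hΦ' hΦo ↦
    hdod_of_cauchyRegion cauchyRegion_holds X D 𝒟 N Φ hΦ hΦ' hΦo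

/-- **Item `SubdataDevelopmentsEmbed` from the two remaining constructions of the printed proof**:
(1) `hloc`, local geometric uniqueness for vacuum Cauchy developments of the same data
(Choquet-Bruhat–Geroch 1969, Thm. 2; Sbierski 2016, Thm. 2.4 (ii)) and (3) `hmax`, a maximal
relative common sub-development of a development of the sub-data and a MAXIMAL development of the
data exhausts the former (Sbierski 2016, Thm. 3.5 with §3.2–3.3) — hypothesis (2), the domain of
dependence, being `hdod_holds`. See `subdataDevelopmentsEmbed_of_skeleton` for the shapes. -/
theorem subdataDevelopmentsEmbed_of_hloc_of_hmax
    (hloc : ∀ (N : Type) [TopologicalSpace N] [ChartedSpace E3 N] [IsManifold (𝓡 3) ∞ N]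
      [ConnectedSpace N] (D₁ : InitialDataSet (𝓡 3) N) (𝒟₁ 𝒟₂ : VacuumCauchyDevelopment D₁),
      ∃ 𝒰 : VacuumCauchyDevelopment D₁,
        𝒰.toCauchyDevelopment.EmbedsInto 𝒟₁.toCauchyDevelopment ∧
          𝒰.toCauchyDevelopment.EmbedsInto 𝒟₂.toCauchyDevelopment)
    (hmax : ∀ (X : Type) [TopologicalSpace X] [ChartedSpace E3 X] [IsManifold (𝓡 3) ∞ X]
      [T2Space X] [SecondCountableTopology X] [ConnectedSpace X] (D : InitialDataSet (𝓡 3) X)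
      (𝒟 : VacuumCauchyDevelopment D), 𝒟.IsMaximal →
      ∀ (N : Type) [TopologicalSpace N] [ChartedSpace E3 N] [IsManifold (𝓡 3) ∞ N]
      [ConnectedSpace N] (Φ : N → X) (hΦ : ContMDiff (𝓡 3) (𝓡 3) (∞ + 1) Φ)
      (hΦ' : ∀ u, Injective (mfderiv (𝓡 3) (𝓡 3) Φ u)), IsOpenEmbedding Φ →
      ∀ (𝒟' : VacuumCauchyDevelopment (D.comap Φ hΦ hΦ')) (U : Opens 𝒟'.carrier)
        (ψ : 𝒟'.carrier → 𝒟.carrier),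
        ((∀ u, 𝒟'.embed u ∈ U) ∧ IsConnected (U : Set 𝒟'.carrier) ∧
        (𝒟'.metric.restrict PseudoRiemannianMetric.contMDiff_restrict_holds U).IsCauchyHypersurface
          (𝒟'.timeOrientation.restrict PseudoRiemannianMetric.contMDiff_restrict_holds
            𝒟'.timeOrientation.contMDiff_restrict_holds U) (Subtype.val ⁻¹' range 𝒟'.embed) ∧
        ContMDiffOn (𝓡 4) (𝓡 4) ∞ ψ U ∧
        (∀ p ∈ U, pullbackBilin (I := 𝓡 4) (I' := 𝓡 4) ψ 𝒟.metric.val p = 𝒟'.metric.val p) ∧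
        (∀ p ∈ U, 𝒟.timeOrientation.IsFutureDirected
          (mfderiv (𝓡 4) (𝓡 4) ψ p (𝒟'.timeOrientation.vectorField p))) ∧
        ψ ∘ 𝒟'.embed = 𝒟.embed ∘ Φ) →
        (∀ (U' : Opens 𝒟'.carrier) (ψ' : 𝒟'.carrier → 𝒟.carrier),
          ((∀ u, 𝒟'.embed u ∈ U') ∧ IsConnected (U' : Set 𝒟'.carrier) ∧
          (𝒟'.metric.restrict PseudoRiemannianMetric.contMDiff_restrict_holds
              U').IsCauchyHypersurface
            (𝒟'.timeOrientation.restrict PseudoRiemannianMetric.contMDiff_restrict_holds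
              𝒟'.timeOrientation.contMDiff_restrict_holds U') (Subtype.val ⁻¹' range 𝒟'.embed) ∧
          ContMDiffOn (𝓡 4) (𝓡 4) ∞ ψ' U' ∧
          (∀ p ∈ U', pullbackBilin (I := 𝓡 4) (I' := 𝓡 4) ψ' 𝒟.metric.val p = 𝒟'.metric.val p) ∧
          (∀ p ∈ U', 𝒟.timeOrientation.IsFutureDirected
            (mfderiv (𝓡 4) (𝓡 4) ψ' p (𝒟'.timeOrientation.vectorField p))) ∧
          ψ' ∘ 𝒟'.embed = 𝒟.embed ∘ Φ) →
          U ≤ U' → EqOn ψ ψ' U → U' = U) →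
        U = ⊤) :
    Summit.FinalStateConjecture.FinalStateConjecture.Theses.SwallowTheDatum.SubdataDevelopmentsEmbed :=
  subdataDevelopmentsEmbed_of_skeleton hloc hdod_holds hmax

end SubdataDevelopmentsEmbed

end Summit.FinalStateConjecture.FinalStateConjecture.Theorems

end
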